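import Mathlib
import Summits.KontsevichZagierPeriods.KontsevichZagierPeriods.Theorems.SoloInformedHookB
import Summits.KontsevichZagierPeriods.KontsevichZagierPeriods.Theorems.SoloInformedHookPieces
import HarnessLib
import HarnessLib.Audit

/-!
# SoloInformed — the hook identities: the initial stage and the identity `HOOK(u, i+1)` (LIII, F6)

Solo programme `solo-KontsevichZagierPeriods-informed`, session s54.  Glues the two halves of
the hook programme.  For an admissible index `u` (weight `m+1`, `k+1` blocks) and `i+1`
bullets, the INITIAL HOOK STAGE has labelling `β` = block number on the chain part and `k+1`
on the bullets, `K = k`, `pos = 0`, `a = x_0`, nothing placed, hanging chain `y_i > ⋯ > y_0`.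
Its first `A`-side has domain `(0,1)ⁿ ∩ {y_i < x_0} ∩ {y_0 < ⋯ < y_i} = HookA m i` and
integrand `G_u(Q(x))/∏_j(1 − y_j) = HookAf`; so

* `SoloInformedHookB.repA_class'` (scale chain + placement sum; rules (1)–(3)) computes its
  class as `Σ (HookWords u 0 (i+1)).map mzvClass` (series side), and
* `soloInformed_hook_integral_class` (rule (2) along `λ`, order cells, simplex pieces) computes
  it as `Σ_{σ ⊨ E} mzvClass (idx_σ)` (integral side).

**THEOREM `soloInformed_hook_identity` (HOOK(u, i+1) in `𝒫`)**:
`Σ_{σ ⊨ E(m,i)} mzvClass (idx_σ(u)) = Σ_{v ∈ HookWords u 0 (i+1)} mzvClass v` — the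
Kaneko–Yamamoto integral-series identity for `μ(u, (1^{i+1}))`, derived inside Kontsevich's
formal period ring from the three rules alone.

References: M. Kaneko, S. Yamamoto, arXiv:1605.03117 Thm 4.1; S. Yamamoto, arXiv:1405.6499;
Kontsevich–Zagier 2001 §1.2.
-/

noncomputable section

open MeasureTheory Set MvPolynomial
open Literature.ModelTheory.ExponentialFields Literature.NumberTheory.Transcendental
open Literature.NumberTheory.Transcendental.KZ

namespace Summit.KontsevichZagierPeriods.KontsevichZagierPeriods.Theorems

variable {m i : ℕ}

/-! ## 1. The hook labelling -/

/-- The hook labelling: block number on the chain part, `k+1` on the bullets. -/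
def soloInformedHookLab (u : List ℕ) (k m i : ℕ) (l : Fin (m + 1 + (i + 1))) : ℕ :=
  if l.1 < m + 1 then soloInformedLabU u l else k + 1

section lab

variable {u : List ℕ} {k : ℕ} (hu : MZV.IsAdmissible u) (hw : MZV.weight u = m + 1)
  (hk : u.length = k + 1)
include hu hw hk

omit hu hw hk in
/-- `β l ≤ t ↔ (l on the chain part ∧ labU l ≤ t)` for `t ≤ k`. -/
theorem soloInformed_hookLab_le_iff (l : Fin (m + 1 + (i + 1))) {t : ℕ} (ht : t ≤ k) :
    soloInformedHookLab u k m i l ≤ t ↔ l.1 < m + 1 ∧ soloInformedLabU u l ≤ t := by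
  unfold soloInformedHookLab
  split_ifs with h
  · simp [h]
  · simp only [h, false_and, iff_false, not_le]; omega

omit hu hw hk in
/-- `β l = t ↔ (l on the chain part ∧ labU l = t)` for `t ≤ k`. -/
theorem soloInformed_hookLab_eq_iff (l : Fin (m + 1 + (i + 1))) {t : ℕ} (ht : t ≤ k) :
    soloInformedHookLab u k m i l = t ↔ l.1 < m + 1 ∧ soloInformedLabU u l = t := by
  unfold soloInformedHookLab
  split_ifs with h
  · simp [h]
  · simp only [h, false_and, iff_false]; omega

/-- **The fibres of the hook labelling below `k` are the entries of `u`.** -/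
theorem soloInformed_fib_hookLab {t : ℕ} (ht : t ≤ k) :
    soloInformedFib (soloInformedHookLab u k m i) t = u[t]'(by omega) := by
  rw [soloInformedFib, ← soloInformed_card_fibreU hu.1 hw hk (by omega : m + 1 ≤ m + 1 + (i + 1)) ht]
  congr 1
  ext l
  simp only [Finset.mem_filter, Finset.mem_univ, true_and, soloInformed_hookLab_eq_iff l ht]

/-- The hook labelling is valid up to `k`. -/
theorem soloInformed_isLabK_hookLab : soloInformedIsLabK (soloInformedHookLab u k m i) k := by
  refine ⟨fun t ht => ?_, ?_⟩
  · rw [soloInformed_fib_hookLab hu hw hk ht]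
    exact hu.1 _ (List.getElem_mem _)
  · rw [soloInformed_fib_hookLab hu hw hk (Nat.zero_le _)]
    have h := hu.2 (List.ne_nil_of_length_eq_add_one hk)
    rwa [List.head_eq_getElem] at h

/-- `cum_k(β) = m + 1`: exactly the chain part is labelled `≤ k`. -/
theorem soloInformed_cum_hookLab : soloInformedCum (soloInformedHookLab u k m i) k = m + 1 := by
  refine Eq.trans ?_
    (soloInformed_card_filter_val_lt (N := m + 1 + (i + 1)) (by omega : m + 1 ≤ m + 1 + (i + 1)))
  rw [soloInformedCum]
  congr 1
  ext l
  simp only [Finset.mem_filter, Finset.mem_univ, true_and,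
    soloInformed_hookLab_le_iff l le_rfl, and_iff_left_iff_imp]
  exact fun hl => soloInformed_labU_le hu.1 hw hk hl

/-- **The index of the hook labelling is `u`.** -/
theorem soloInformed_idx_hookLab : soloInformedIdx (soloInformedHookLab u k m i) (k + 1) = u := by
  apply List.ext_getElem (by rw [soloInformed_length_idx, hk])
  intro t h1 h2
  rw [soloInformed_idx_getElem, soloInformed_fib_hookLab hu hw hk (by omega)]

/-- **The chain products of the hook labelling are the `u`-prefix products** (`t ≤ k`). -/
theorem soloInformed_BP_hookLab (x : Fin (m + 1 + (i + 1)) → ℝ) {t : ℕ} (ht : t ≤ k) :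
    soloInformedBP (soloInformedHookLab u k m i) x t = soloInformedQU (m + 1 + i) u x t := by
  unfold soloInformedBP soloInformedQU
  rw [← soloInformed_filter_labU_le hu.1 hw hk ht]
  congr 1
  ext l
  simp only [Finset.mem_filter, Finset.mem_univ, true_and, soloInformed_hookLab_le_iff l ht]

/-- The label of `x_0` is `0`. -/
theorem soloInformed_hookLab_zero : soloInformedHookLab u k m i (Fin.castAdd (i + 1) 0) = 0 := by
  have h := (soloInformed_hookLab_le_iff (u := u) (m := m) (i := i) (Fin.castAdd (i + 1) 0)
    (Nat.zero_le k)).2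
    ⟨by simp, (soloInformed_labU_le_iff hu.1 hw hk (by simp) (Nat.zero_le k)).2
      (lt_of_lt_of_le Nat.zero_lt_one (soloInformed_one_le_ends_getD hu.1 (by omega)))⟩
  omega

omit hu hw hk in
/-- Bullets are labelled `k + 1`. -/
@[simp] theorem soloInformed_hookLab_natAdd (j : Fin (i + 1)) :
    soloInformedHookLab u k m i (Fin.natAdd (m + 1) j) = k + 1 := by
  unfold soloInformedHookLab
  rw [if_neg (by simp only [Fin.val_natAdd]; omega)]

end lab

/-! ## 2. Descending lists of coordinates -/

section desc

variable {N : ℕ}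

/-- The descending list `[f(i−1), …, f(0)]` below the top `f(i)` of `f : Fin (i+1) → Fin N`. -/
def soloInformedDescList : (i : ℕ) → (Fin (i + 1) → Fin N) → List (Fin N)
  | 0, _ => []
  | i + 1, f => f (Fin.castSucc (Fin.last i)) :: soloInformedDescList i (f ∘ Fin.castSucc)

/-- Auxiliary (hook base): `soloInformedDescList_zero`. -/
@[simp] theorem soloInformedDescList_zero (f : Fin 1 → Fin N) : soloInformedDescList 0 f = [] := rfl

/-- Auxiliary (hook base): `soloInformedDescList_succ`. -/
theorem soloInformedDescList_succ (i : ℕ) (f : Fin (i + 2) → Fin N) :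
    soloInformedDescList (i + 1) f =
      f (Fin.castSucc (Fin.last i)) :: soloInformedDescList i (f ∘ Fin.castSucc) := rfl

/-- The descending list has length `i`. -/
@[simp] theorem soloInformed_length_descList : ∀ (i : ℕ) (f : Fin (i + 1) → Fin N),
    (soloInformedDescList i f).length = i
  | 0, _ => rfl
  | i + 1, f => by rw [soloInformedDescList_succ, List.length_cons, soloInformed_length_descList]

/-- Membership in the descending list. -/
theorem soloInformed_mem_descList : ∀ (i : ℕ) (f : Fin (i + 1) → Fin N) (t : Fin N),
    t ∈ soloInformedDescList i f ↔ ∃ j : Fin i, t = f (Fin.castSucc j)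
  | 0, _, _ => by simp
  | i + 1, f, t => by
    rw [soloInformedDescList_succ, List.mem_cons, soloInformed_mem_descList]
    constructor
    · rintro (rfl | ⟨j, rfl⟩)
      · exact ⟨Fin.last i, rfl⟩
      · exact ⟨Fin.castSucc j, rfl⟩
    · rintro ⟨j, rfl⟩
      rcases Fin.eq_castSucc_or_eq_last j with ⟨j, rfl⟩ | rfl
      · exact Or.inr ⟨j, rfl⟩
      · exact Or.inl rfl

/-- For injective `f` the list `f(i) :: [f(i−1), …, f(0)]` is duplicate-free. -/
theorem soloInformed_nodup_cons_descList : ∀ (i : ℕ) {f : Fin (i + 1) → Fin N},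
    Function.Injective f → (f (Fin.last i) :: soloInformedDescList i f).Nodup
  | 0, _, _ => by simp
  | i + 1, f, hf => by
    rw [soloInformedDescList_succ, List.nodup_cons]
    refine ⟨fun h => ?_, ?_⟩
    · rcases List.mem_cons.1 h with h | h
      · exact absurd (hf h) (by simp [Fin.ext_iff])
      · obtain ⟨j, hj⟩ := (soloInformed_mem_descList _ _ _).1 h
        exact absurd (hf hj) (by simp [Fin.ext_iff]; omega)
    · exact soloInformed_nodup_cons_descList i (hf.comp (Fin.castSucc_injective _))

/-- **The chain below the top of `f` is the increasing chain `f(0) < f(1) < ⋯ < f(i)`.** -/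
theorem soloInformed_mem_chainSet_descList : ∀ (i : ℕ) (f : Fin (i + 1) → Fin N) (x : Fin N → ℝ),
    x ∈ soloInformedChainSet (f (Fin.last i)) (soloInformedDescList i f) ↔
      ∀ j : Fin i, x (f (Fin.castSucc j)) < x (f j.succ)
  | 0, _, _ => by simp
  | i + 1, f, x => by
    have ih : x ∈ soloInformedChainSet (f (Fin.castSucc (Fin.last i)))
        (soloInformedDescList i (f ∘ Fin.castSucc)) ↔
          ∀ j : Fin i, x (f (Fin.castSucc (Fin.castSucc j))) < x (f (Fin.castSucc j.succ)) :=
      soloInformed_mem_chainSet_descList i (f ∘ Fin.castSucc) x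
    rw [soloInformedDescList_succ, soloInformedChainSet_cons, mem_inter_iff, mem_setOf_eq, ih,
      Fin.forall_fin_succ']
    simp only [Fin.succ_last, Fin.succ_castSucc]
    exact and_comm

/-- Products over the descending list. -/
theorem soloInformed_prod_map_descList : ∀ (i : ℕ) (f : Fin (i + 1) → Fin N) (g : Fin N → ℝ),
    ((soloInformedDescList i f).map g).prod = ∏ j : Fin i, g (f (Fin.castSucc j))
  | 0, _, _ => by simp
  | i + 1, f, g => by
    rw [soloInformedDescList_succ, List.map_cons, List.prod_cons, soloInformed_prod_map_descList i,
      Fin.prod_univ_castSucc, mul_comm]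
    rfl

/-- Products over the duplicate-free descending list, with the top. -/
theorem soloInformed_prod_toFinset_descList (i : ℕ) {f : Fin (i + 1) → Fin N}
    (hf : Function.Injective f) (g : Fin N → ℝ) :
    (∏ t ∈ (soloInformedDescList i f).toFinset, g t) * g (f (Fin.last i)) =
      ∏ j : Fin (i + 1), g (f j) := by
  rw [List.prod_toFinset _ (List.nodup_cons.1 (soloInformed_nodup_cons_descList i hf)).2,
    soloInformed_prod_map_descList, Fin.prod_univ_castSucc]

end desc

/-! ## 3. The initial hook stage -/

section init

variable {u : List ℕ} {k : ℕ} (hu : MZV.IsAdmissible u) (hw : MZV.weight u = m + 1)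
  (hk : u.length = k + 1)

/-- **The initial hook stage** of `(u, i+1)`: nothing placed, `a = x_0`, hanging chain
`y_i > y_{i-1} > ⋯ > y_0`. -/
def soloInformedHookStageInit (i : ℕ) : SoloInformedHookStage (m + 1 + i + 1) where
  β := soloInformedHookLab u k m i
  K := k
  pos := 0
  a := Fin.castAdd (i + 1) 0
  bs := []
  c := Fin.natAdd (m + 1) (Fin.last i)
  cs := soloInformedDescList i (Fin.natAdd (m + 1))
  isLabK := soloInformed_isLabK_hookLab hu hw hk
  pos_le := Nat.zero_le _
  β_a := soloInformed_hookLab_zero hu hw hk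
  lt_β x hx := by
    rw [List.nil_append, List.mem_cons, soloInformed_mem_descList] at hx
    rcases hx with rfl | ⟨j, rfl⟩ <;> (rw [soloInformed_hookLab_natAdd]; omega)
  nodup := by
    rw [List.nil_append]
    exact soloInformed_nodup_cons_descList i (Fin.natAdd_injective (i + 1) (m + 1))

include hu hw hk

/-- All coordinates are accounted for: `cum_k(β) + (i + 1) = n`. -/
theorem soloInformed_hookStageInit_cum :
    soloInformedCum (soloInformedHookStageInit hu hw hk i).β (soloInformedHookStageInit hu hw hk i).K +
      ((soloInformedHookStageInit hu hw hk i).bs ++ (soloInformedHookStageInit hu hw hk i).c ::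
        (soloInformedHookStageInit hu hw hk i).cs).length = m + 1 + i + 1 := by
  show soloInformedCum (soloInformedHookLab u k m i) k +
      (([] : List (Fin (m + 1 + (i + 1)))) ++ Fin.natAdd (m + 1) (Fin.last i) ::
        soloInformedDescList i (Fin.natAdd (m + 1))).length = m + 1 + i + 1
  rw [soloInformed_cum_hookLab hu hw hk, List.nil_append, List.length_cons,
    soloInformed_length_descList]
  omega

/-- **The first `A`-side of the initial stage lives on `HookA m i`.** -/
theorem soloInformed_hookStageInit_domain
    (hA : IntegrableOn (soloInformedHookStageInit hu hw hk i).pre.fA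
      (soloInformedHookStageInit hu hw hk i).pre.T₀.DA) :
    ((soloInformedHookStageInit hu hw hk i).pre.toDatum hA).repA.domain = soloInformedHookA m i := by
  rw [SoloInformedHookStage.repA_domain_of_nil _ hA rfl]
  ext x
  simp only [soloInformedHookStageInit, soloInformedHookA, mem_inter_iff, mem_setOf_eq,
    soloInformed_mem_chainSet_descList]
  tauto

/-- **The first `A`-side of the initial stage has integrand `HookAf`** on `HookA m i`. -/
theorem soloInformed_hookStageInit_integrand
    (hA : IntegrableOn (soloInformedHookStageInit hu hw hk i).pre.fA
      (soloInformedHookStageInit hu hw hk i).pre.T₀.DA)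
    {x : Fin (m + 1 + (i + 1)) → ℝ} (hx : x ∈ soloInformedHookA m i) :
    ((soloInformedHookStageInit hu hw hk i).pre.toDatum hA).repA.integrand x =
      soloInformedHookAf u k m i x := by
  rw [SoloInformedHookStage.repA_integrand_of_nil _ hA rfl hx.1.1, soloInformedHookAf]
  show soloInformedGQ (List.ofFn fun t : Fin (k + 1) => soloInformedBP (soloInformedHookLab u k m i) x t) /
      ((∏ t ∈ (soloInformedDescList i (Fin.natAdd (m + 1))).toFinset, (1 - x t)) *
        (1 - x (Fin.natAdd (m + 1) (Fin.last i)))) = _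
  rw [soloInformed_prod_toFinset_descList i (Fin.natAdd_injective (i + 1) (m + 1)) (fun t => 1 - x t)]
  congr 2
  exact List.ofFn_inj.2 (funext fun t => soloInformed_BP_hookLab hu hw hk x (by omega))

/-! ## 4. The hook identity -/

/-- **THEOREM (LIII; HOOK(u, i+1) in `𝒫`).**  For every admissible index `u` of weight `m + 1`
and every `i`:
`Σ_{σ ⊨ E(m,i)} mzvClass (idx_σ(u)) = Σ_{v ∈ HookWords u 0 (i+1)} mzvClass v`
— the integral side (the hook 2-poset integral expanded over its linear extensions) equals the
series side (the placement/word evolution of `u` by `i+1` letters `1`), in Kontsevich's formal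
period ring, from rules (1)–(3) alone.  [Kaneko–Yamamoto arXiv:1605.03117 Thm 4.1 for
`l = (1^{i+1})`; KZ 2001 §1.2] -/
theorem soloInformed_hook_identity (i : ℕ) :
    ∑ σ ∈ Finset.univ.filter (soloInformedCompat (soloInformedHookPoset m i)),
        mzvClass (soloInformedHookIdxσ u m i σ) =
      ((soloInformedHookWords u 0 (i + 1)).map mzvClass).sum := by
  have hcum := soloInformed_hookStageInit_cum hu hw hk (i := i)
  have hA := (soloInformedHookStageInit hu hw hk i).integrableOn_fA hcum
  have h1 := (soloInformedHookStageInit hu hw hk i).repA_class' hcum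
  have h2 := soloInformed_hook_integral_class hu hw hk _
    (soloInformed_hookStageInit_domain hu hw hk hA)
    (fun x hx => soloInformed_hookStageInit_integrand hu hw hk hA hx)
  rw [← h2, h1]
  show ((soloInformedHookWords (soloInformedIdx (soloInformedHookLab u k m i) (k + 1)) 0
    (([] : List (Fin (m + 1 + (i + 1)))) ++ Fin.natAdd (m + 1) (Fin.last i) ::
      soloInformedDescList i (Fin.natAdd (m + 1))).length).map mzvClass).sum = _
  rw [soloInformed_idx_hookLab hu hw hk, List.nil_append, List.length_cons,
    soloInformed_length_descList]

end init

end Summit.KontsevichZagierPeriods.KontsevichZagierPeriods.Theorems
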